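import Summits.QuantumFields.YangMills.Theorems.BalabanUVNodesN12DirectSurjHullCountUniformB

/-!
# BalabanUVNodes ∕ N12 — (D1)⁵ §2, UNIFORM-`B₁` EDITION («v10.1», display unchanged): the (P4)′ letter family `hHrow` of the direct row of record is INHABITED WITH ITS TWO CONSTANTS
# `εH`, `B₁` CHOSEN PER HEIGHT — before `ν`, `M₁`, `Z` — by dag-n12-w6 g9's `N12DirectSurjHullCountUniformB.exists_rightInverse_hrow_uniformB`

Cell `pub-ymgap` (HUMAN RULINGS D-0062 ∕ D-0149), seat `pub-ymgap-dag-n12-d` g21 (R134 N12 [B15] s2; lane booking INBOX l.45004 «N12 DIRECT ROW SOCKET OF RECORD := v10 p688682 ∕ p688712 …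
fidelity note (c) U4 … + `B` per (M₁,Z) (w6 LOCATED-B; hull count in flight)», dag-n12-w6 g9 CLAIM-2 ∕ INTENT-2 l.45069 «LOCATED-B, QUANTIFIER HALF — `B` PER HEIGHT … consumer impact:
n12-d's `exists_rowPreimageProxiesLetter_family` can choose `εH, B₁` BEFORE `ν.M₁, Z i` from (c)»).  Count-neutral helper of K1⁹ `stmt-QuantumFields-27364` (`--kind proof --supports …
--as helper`).  THEOREMS ONLY (0 `def`, 0 `instance`, 0 `sorry`); composition BY NAME of dag-n12-w6 g9's `exists_rightInverse_hrow_uniformB` — nothing else.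

WHY.  (D1)⁵ `N12Prop1DirectOfClassOnlyRowL1` (p687816) DISPLAYS the (P4)′ letter family `hHrow i : ∀ Wd U₀, AgreeOn → (guarded proxy per constrained bond) → (guarded proxy per inner site) →
(tower-box plaquette smallness εH i) → ∃ H, hHinv ∧ (per-row ℓ¹ preimage letter at B₁ i)` at binders `εH B₁ : ι → ℝ`, and its §2 `exists_rowPreimageProxiesLetter_family` inhabited it for
a FIXED `ν` and a FIXED family `Z` (`∃ εH, ∃ B₁, ∀ i Wd U₀ …` AFTER `(ν, Z)`: dag-n12-w6 g7's p678596 chose `B` after `(M₁, Z)`, and the inhabitant `√#bonds(Ω₁(Z_i))·B i` read the region).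
dag-n12-w6 g9's uniform-`B` edition moves `∃ B` in front of `∀ M₁ Z` (the flat chart derivative's norm letter `Λ♭` for EVERY determining set) and its hull count `h(d,L,k) =
2d(k+1)(2d+1)^k·L^{kd}` gives the per-row letter at `B₁ = h·B` — PER HEIGHT.  THIS FILE re-keys §2 on it: `∃ εH B₁ : ι → ℝ` (functions of the height family `k` alone) `∀ ν (2 ≤ M₁) Z
(hdiv) i Wd U₀ …` — so in the display of record the (P4)′ constants `εH B₁` join `C ρ Kτ ρτ ρ5 ρ6 M₂` as letters dischargeable BEFORE `ν` and the instance; the lane's fidelity note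
(c) loses its «+ `B` per (M₁,Z)» clause.  The DISPLAY ((D1)⁵ ∕ (E1)⁶ ∕ «12Q∕12X-W-DIRECT v10») is UNCHANGED — only the junction's quantifier order improves.

WHAT.  ★★ `exists_rowPreimageProxiesLetter_family_uniformB (Kt) (k : ι → ℕ) (hk1 : ∀ i, k i + 1 ≤ m + K)` :
`∃ εH, (∀ i, 0 < εH i) ∧ ∃ B₁, (∀ i, 0 ≤ B₁ i) ∧ ∀ ν, 2 ≤ ν.M₁ → ∀ Z, (∀ i, side L ν.M₁ (k i) ∣ sitesPerDir 0) → ∀ i Wd U₀,` (D1)⁵'s `hHrow i Wd U₀` body VERBATIM.  Proof: `choose` over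
`exists_rightInverse_hrow_uniformB (k := k i) (hk1 i)`, dropping its two norm conjuncts.

HONEST FRAMING ∕ LOCATED.  ∃∕∀ bookkeeping by name (quantifier order only); `B₁ i`'s VALUE still carries `C_p = #PBond` through dag-n12-w6's threshold∕`Λ` bookkeeping (their LOCATED-ε∕B-VALUE,
census U4 «not print's numbers») — print's volume-free (46) NOT claimed; nothing of Bałaban's asserted; count-neutral; N12 NOT discharged; K1⁹ NOT closed; counts unmoved; one finite 𝕋⁴
programme at fixed `ε = L^{-K}` — R4 closes only the conditional rung `BalabanLadder.UV`; no summit statement is proved here and NOT the Yang–Mills mass gap (Clay); nothing continuum ∕ ℝ⁴ ∕ OS.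

References: [Balaban1985Variational] CMP 102 (1985) 277–309, (44)–(47) p.285, (83) p.290; [Balaban1988Convergent] CMP 119 (1988) 243–285, (2.2) p.255, (2.10)–(2.13) pp.256–257;
[Balaban1989LargeFieldII] CMP 122 (1989) 355–392, (1.13) p.359.
-/

noncomputable section

open scoped BigOperators Matrix.Norms.L2Operator

namespace Summit.QuantumFields.YangMills.BalabanUVNodes.N12Prop1DirectOfClassOnlyRowL1UniformB

open Literature.MathematicalPhysics.QuantumFieldTheory.Balaban1983to89
open Node00 B15DeterminingSets GaugeField
open T4Continuum (T4Family)
open T4AdjointCovarianceUnitary (lieSU)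
open T4CubeChartGnomonic (SU2)
open B14.Eq213DetSet (Bj maxDomT)
open B14.Eq213MaximalDomains (side)
open B14.Eq216Concrete (feeds)
open B5Eq118OneStroke (iterBlockOf)
open B15Eq112TorusCover (lift)
open T4AxialGaugeSmallField (boxPlaqs)
open Summit.QuantumFields.YangMills.BalabanUVNodes.N12DirectSurjHullCountUniformB (exists_rightInverse_hrow_uniformB)

variable {F : T4Family}

/-- ★★ **JUNCTION, UNIFORM-`B₁` EDITION (count-neutral)**: (D1)⁵'s displayed (P4)′ letter family `hHrow` (p687816 :§1, premises = dag-n12-w6's p678596 VERBATIM, conclusion = a right inverse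
`H` + the per-row ℓ¹ preimage letter at `B₁ i`) is inhabited with `εH i > 0` AND `B₁ i ≥ 0` depending on the HEIGHT `k i` ALONE — chosen before `ν`, `M₁`, the family `Z` and the instance —
by dag-n12-w6 g9's `exists_rightInverse_hrow_uniformB` (`B₁ = h(d,L,k)·B`, `h = 2d(k+1)(2d+1)^k·L^{kd}`).  Compare (D1)⁵ §2 `exists_rowPreimageProxiesLetter_family` (constants after `(ν, Z)`,
`B₁ i = √#bonds(Ω₁(Z_i))·B i`).  Needs `k i + 1 ≤ m + K`; at use `2 ≤ ν.M₁` and (2.13)'s divisibility per instance.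
[cite: Balaban1985Variational, (44)–(47) p.285, (83) p.290; Balaban1988Convergent, (2.2) p.255, (2.11)–(2.13) pp.256–257; Balaban1989LargeFieldII, (1.13) p.359] -/
theorem exists_rowPreimageProxiesLetter_family_uniformB (Kt : ℕ) {ι : Type} (k : ι → ℕ) (hk1 : ∀ i, k i + 1 ≤ (F.P Kt).m + (F.P Kt).K) :
    ∃ εH : ι → ℝ, (∀ i, 0 < εH i) ∧ ∃ B₁ : ι → ℝ, (∀ i, 0 ≤ B₁ i) ∧
      ∀ (ν : Node00.Stage7Numerics), 2 ≤ ν.M₁ → ∀ (Z : ι → Set (Site (F.P Kt) 0)), (∀ i, side (F.P Kt).L ν.M₁ (k i) ∣ (F.P Kt).sitesPerDir 0) →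
      ∀ i (Wd : MSField (F.P Kt) SU2) (U₀ : GaugeField (F.P Kt) 0 SU2),
      AgreeOn (Bj ν.M₁ (Z i) (k i)) (avgFamily (Node00.avOfRecord F 2 Kt) U₀) Wd →
      (∀ i' : Fin (constrCard (Bj ν.M₁ (Z i) (k i)) (k i)), ∃ U' : GaugeField (F.P Kt) 0 SU2,
        (∀ b ∈ feeds (((constrEnum (Bj ν.M₁ (Z i) (k i)) (k i)).symm i').1 : ℕ) ((constrEnum (Bj ν.M₁ (Z i) (k i)) (k i)).symm i').2.1, U' b = U₀ b) ∧
          Node00.SmallBelow (Node00.avOfRecord F 2 Kt) (k i) U') →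
      (∀ (j : ℕ), 1 ≤ j → j ≤ k i → ∀ y : Site (F.P Kt) j, embIter j y ∈ maxDomT ν.M₁ (Z i) j → ∃ U' : GaugeField (F.P Kt) 0 SU2,
        (∀ c : PBond (F.P Kt) j, (c.src = y ∨ c.tgt = y) → ∀ b₀ : PBond (F.P Kt) 0,
          (iterBlockOf j b₀.src = c.src ∨ iterBlockOf j b₀.src = c.tgt) → (iterBlockOf j b₀.tgt = c.src ∨ iterBlockOf j b₀.tgt = c.tgt) → U' b₀ = U₀ b₀) ∧
        Node00.SmallBelow (Node00.avOfRecord F 2 Kt) (k i) U') →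
      (∀ (j : ℕ), 1 ≤ j → j ≤ k i → ∀ y : Site (F.P Kt) j, embIter j y ∈ maxDomT ν.M₁ (Z i) j →
        PlaqSmallOn (boxPlaqs (fun κ => lift (F.P Kt) (embIter j y) κ - ((((F.P Kt).L ^ j : ℕ) : ℤ) + ((((F.P Kt).L ^ j - 1) / 2 : ℕ) : ℤ)))
          (fun κ => lift (F.P Kt) (embIter j y) κ + ((((F.P Kt).L ^ j : ℕ) : ℤ) + ((((F.P Kt).L ^ j - 1) / 2 : ℕ) : ℤ))) : Set (Plaq (F.P Kt) 0)) (εH i) U₀) →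
      ∃ H : (Fin (constrCard (Bj ν.M₁ (Z i) (k i)) (k i)) → lieSU (Fin 2)) → PBond (F.P Kt) 0 → lieSU (Fin 2),
        (∀ v, fderiv ℝ (msChart F 2 Kt (k i) (Bj ν.M₁ (Z i) (k i)) Wd U₀) 0 (H v) = v) ∧
        ∀ i' : Fin (constrCard (Bj ν.M₁ (Z i) (k i)) (k i)), 1 ≤ ((((constrEnum (Bj ν.M₁ (Z i) (k i)) (k i)).symm i').1 : ℕ)) → ∀ ξ : lieSU (Fin 2),
          ∃ x : PBond (F.P Kt) 0 → lieSU (Fin 2), fderiv ℝ (msChart F 2 Kt (k i) (Bj ν.M₁ (Z i) (k i)) Wd U₀) 0 x = Pi.single i' ξ ∧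
            ∑ b, ‖(x b : Matrix (Fin 2) (Fin 2) ℂ)‖ ≤ B₁ i * ‖ξ‖ := by
  choose εH hεH B₁ hB1 hB using fun i => exists_rightInverse_hrow_uniformB (F := F) (N := 2) (K := Kt) (k := k i) (hk1 i)
  refine ⟨εH, hεH, B₁, hB1, fun ν hM2 Z hdiv i Wd U₀ hU hprox hproxS hbox => ?_⟩
  obtain ⟨H, hHinv, -, -, hrow⟩ := hB i ν.M₁ (le_trans one_le_two hM2) (Z i) (hdiv i) Wd U₀ hU hprox hproxS hbox
  exact ⟨H, hHinv, hrow⟩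

end Summit.QuantumFields.YangMills.BalabanUVNodes.N12Prop1DirectOfClassOnlyRowL1UniformB

end
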